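import Summits.Ventures.LatticeQCDFlow.Scoring.SlidingWindowKernel

/-!
# The SLIDING-WINDOW CHAIN of a chain with a Doeblin power: the windows `(X_k, …, X_{k+W})` form a
# Markov chain with a Doeblin power, its invariant law is the stationary law of a window, and the law
# of the window path under `P_{μ₀}` IS the window chain

HONEST FRAMING: exact (Metropolis-corrected) sampling algorithms for lattice gauge theory;
figures of merit are autocorrelation/cost numbers at stated couplings and volumes; no
continuum-physics claim.

Venture `LatticeQCDFlow` (cell pub-lqcd), sub-topic `Scoring`; FANOUT row 16 (`su2-base`), GEN-9.
NEW WORK of the cell (our formalisation of a classical device), not a published result; no definition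
is introduced; nothing is cited as a fact.  With `κ_W = windowKernel κ W`
(`Scoring/SlidingWindowKernel.lean`) and its `n`-step formula `iterate_kop_windowKernel`, this file
proves the three facts that let every any-start theorem of rows 8/13 for ONE-time observables of a
chain with a Doeblin power (`(nHit κ m)(z, ·) ≥ ε ν`) be applied to functionals of `W + 1` consecutive
states — lag products `f(X_k) f(X_{k+t})`, `t ≤ W`, in the first place:

* **`windowKernel_minorised_of_nHit`** — THE DOEBLIN POWER TRANSFERS: if `(nHit κ m)(z, ·) ≥ ε ν` for
  all `z`, then `(nHit κ_W (m + W))(y, ·) ≥ ε ν_W` for ALL windows `y`, with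
  `ν_W = law of (X_0, …, X_W) under P_ν` (after `m + W` steps every old coordinate is flushed; the
  Markov property at time `m` and the mixture formula `P_{μ₀} = ∫ P_{δ_z} dμ₀`);
* **`invariant_windowKernel`** — `π` invariant for `κ` ⇒ `π_W = law of (X_0, …, X_W) under P_π` is
  invariant for `κ_W` (the joint tower identity at time `W` and stationarity of `P_π` under the shift,
  row 13's `measurePreserving_shift_chain`);
* **`chain_map_windowPath`** — IDENTIFICATION OF PATH LAWS: for EVERY initial law `μ₀`, the image of
  `P_{μ₀}` under `x ↦ (k ↦ (x_k, …, x_{k+W}))` is the `κ_W`-chain started from the law of the initial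
  window `(X_0, …, X_W)` (row 8's uniqueness-by-tower-identities `Scoring.eq_chain_of_tower`);
* `invariant_of_forall_integral_real` — bookkeeping: a Markov kernel leaves a probability law
  invariant as soon as `∫ η(v, B) dμ(v) = μ(B)` for measurable `B` (the window bookkeeping lemma
  `windowPath_congr` is in `Scoring/SlidingWindowKernel`).

So a statistic `(1/N) Σ_k φ(X_k, …, X_{k+W})` of the chain from `μ₀` is, in law, the time average of the
one-time observable `φ` along a chain with a Doeblin power (constant `ε`, power `m + W`) started from
some initial law — and rows 8/13's every-start theorems apply verbatim (next file:
`Scoring/ChainWindowFunctionalCLT.lean`).  NOT CLAIMED: a one-step minorisation of `κ_W` (false in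
general for `W ≥ 1`); reversibility of `κ_W` (false); anything quantitative beyond the constant.
-/

noncomputable section

open MeasureTheory ProbabilityTheory Filter Finset Preorder
open scoped ENNReal Topology
open Summit.Ventures.LatticeQCDFlow.Exactness Summit.Ventures.LatticeQCDFlow.Exactness.GeneralNCMC

namespace Summit.Ventures.LatticeQCDFlow.Scoring

variable {S : Type*} [MeasurableSpace S]

/-! ## Bookkeeping: invariance from set-wise integrals -/

section Bookkeeping

/-- A Markov kernel `η` leaves the probability law `μ` invariant as soon as
`∫ η(v, B) μ(dv) = μ(B)` for every measurable `B` (real-valued form). -/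
theorem invariant_of_forall_integral_real {T : Type*} [MeasurableSpace T] (η : Kernel T T)
    [IsMarkovKernel η] (μ : Measure T) [IsProbabilityMeasure μ]
    (h : ∀ B, MeasurableSet B → ∫ v, (η v).real B ∂μ = μ.real B) : Kernel.Invariant η μ := by
  show μ.bind η = μ
  ext B hB
  rw [Measure.bind_apply hB (Kernel.aemeasurable η)]
  have hmeas : Measurable fun v => (η v).real B := (Kernel.measurable_coe η hB).ennreal_toReal
  have hint : Integrable (fun v => (η v).real B) μ :=
    integrable_of_bounded μ hmeas (C := 1) fun v => by
      rw [abs_of_nonneg measureReal_nonneg]; exact measureReal_le_one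
  calc ∫⁻ v, η v B ∂μ = ∫⁻ v, ENNReal.ofReal ((η v).real B) ∂μ := by
        refine lintegral_congr fun v => ?_
        rw [ofReal_measureReal]
    _ = ENNReal.ofReal (∫ v, (η v).real B ∂μ) :=
        (ofReal_integral_eq_lintegral_ofReal hint (ae_of_all _ fun v => measureReal_nonneg)).symm
    _ = μ B := by rw [h B hB, ofReal_measureReal]

end Bookkeeping

section WindowChain

variable (κ : Kernel S S) [IsMarkovKernel κ] (W : ℕ)

/-! ## The Doeblin power transfers to the window chain -/

/-- **THE DOEBLIN POWER OF THE WINDOW CHAIN.**  If `(nHit κ m)(z, ·) ≥ ε ν` for all `z`, then for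
EVERY window `y`: `(nHit (windowKernel κ W) (m + W))(y, ·) ≥ ε ν_W`, where
`ν_W = P_ν.map (x ↦ (x_0, …, x_W))` is the law of the initial window of the chain started from `ν`. -/
theorem windowKernel_minorised_of_nHit {ν : Measure S} [IsProbabilityMeasure ν] {ε : ℝ≥0∞} {m : ℕ}
    (hmin : ∀ z, ε • ν ≤ nHit κ m z) (y : Fin (W + 1) → S) :
    ε • (Kernel.trajMeasure (X := fun _ : ℕ => S) ν
        (fun n : ℕ => κ.comap (fun hh : (i : ↥(Finset.Iic n)) → S => hh ⟨n, Finset.mem_Iic.2 le_rfl⟩)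
          (measurable_pi_apply _))).map (fun x : ℕ → S => windowPath W x 0)
      ≤ nHit (windowKernel κ W) (m + W) y := by
  set Pν := Kernel.trajMeasure (X := fun _ : ℕ => S) ν
    (fun n : ℕ => κ.comap (fun hh : (i : ↥(Finset.Iic n)) → S => hh ⟨n, Finset.mem_Iic.2 le_rfl⟩)
      (measurable_pi_apply _)) with hPν
  set P := Kernel.trajMeasure (X := fun _ : ℕ => S) (Measure.dirac (y (Fin.last W)))
    (fun n : ℕ => κ.comap (fun hh : (i : ↥(Finset.Iic n)) → S => hh ⟨n, Finset.mem_Iic.2 le_rfl⟩)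
      (measurable_pi_apply _)) with hP
  haveI : IsProbabilityMeasure (Pν.map (fun x : ℕ → S => windowPath W x 0)) :=
    Measure.isProbabilityMeasure_map (measurable_windowPath_at 0).aemeasurable
  haveI := isMarkovKernel_nHit (windowKernel κ W) (m + W)
  haveI := isMarkovKernel_nHit κ m
  haveI : Nonempty S := ⟨y (Fin.last W)⟩
  have hε1 : ε ≤ 1 := eps_le_one_of_minorised hmin
  rw [Measure.le_iff]
  intro B hB
  rw [Measure.smul_apply, smul_eq_mul]
  -- the indicator of `B` read on the initial window, and its expectation from a Dirac start
  have h1B : Measurable (B.indicator (1 : (Fin (W + 1) → S) → ℝ)) := measurable_one.indicator hB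
  have h1Bb : ∀ v, |B.indicator (1 : (Fin (W + 1) → S) → ℝ) v| ≤ 1 := fun v => by
    by_cases hv : v ∈ B <;> simp [hv]
  set Ψ : (ℕ → S) → ℝ := fun x' => B.indicator (1 : (Fin (W + 1) → S) → ℝ) (windowPath W x' 0) with hΨ
  have hΨm : Measurable Ψ := h1B.comp (measurable_windowPath_at 0)
  have hΨb : ∀ x', |Ψ x'| ≤ 1 := fun x' => h1Bb _
  set Λ : S → ℝ := fun u => ∫ x', Ψ x' ∂(Kernel.trajMeasure (X := fun _ : ℕ => S) (Measure.dirac u)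
    (fun n : ℕ => κ.comap (fun hh : (i : ↥(Finset.Iic n)) → S => hh ⟨n, Finset.mem_Iic.2 le_rfl⟩)
      (measurable_pi_apply _))) with hΛ
  have hΛm : Measurable Λ := measurable_chain_dirac_integral κ hΨm
  have hΛb : ∀ u, |Λ u| ≤ 1 := fun u => abs_chain_dirac_integral_le κ hΨb u
  have hΛ0 : ∀ u, 0 ≤ Λ u := fun u => integral_nonneg fun x' => by
    simp only [hΨ]
    by_cases hv : windowPath W x' 0 ∈ B <;> simp [hv]
  -- Step 1: `κ_W^{m+W}(y, B)` is the probability that the `m`-th window of the chain from `y_W` is in `B`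
  have hstep1 : (nHit (windowKernel κ W) (m + W) y).real B = ∫ x, Ψ (fun n => x (m + n)) ∂P := by
    rw [← integral_indicator_one hB, ← iterate_kop_eq_integral_nHit h1B h1Bb (m + W) y,
      iterate_kop_windowKernel κ W h1B h1Bb (m + W) y]
    refine integral_congr_ae (ae_of_all _ fun x => ?_)
    show B.indicator (1 : (Fin (W + 1) → S) → ℝ) (windowPath W (splicePath W y x) (m + W))
      = Ψ (fun n => x (m + n))
    rw [windowPath_splicePath_add]
    simp only [hΨ]
    congr 1
    funext i
    simp only [windowPath_apply, Nat.zero_add]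
  -- Step 2: the Markov property at time `m`
  have hstep2 : ∫ x, Ψ (fun n => x (m + n)) ∂P = ∫ x, Λ (x m) ∂P := by
    have h := chain_markov_dependsOn κ (Measure.dirac (y (Fin.last W))) m (G := fun _ => (1 : ℝ))
      measurable_const (fun _ _ _ => rfl) (CG := 1) (fun _ => by simp) hΨm hΨb
    simpa only [one_mul] using h
  -- Step 3: the time-`m` marginal from the Dirac start is `κ^m(y_W, ·)`
  have hstep3 : ∫ x, Λ (x m) ∂P = ∫ u, Λ u ∂(nHit κ m (y (Fin.last W))) := by
    have h := chain_tower_iterate κ (Measure.dirac (y (Fin.last W))) 0 (F := fun _ => (1 : ℝ))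
      measurable_const (CF := 1) (fun _ => by simp) m hΛm hΛb
    simp only [one_mul, Nat.zero_add] at h
    rw [← hP] at h
    obtain ⟨hKm, hKb⟩ := iterate_kop_bounded_measurable κ hΛm hΛb m
    rw [h, chain_integral_eval_zero κ _ hKm, integral_dirac' _ _ hKm.stronglyMeasurable,
      iterate_kop_eq_integral_nHit hΛm hΛb m]
  -- Step 4: the minorisation, integrated against the nonnegative `Λ`
  have hstep4 : ε.toReal * ∫ u, Λ u ∂ν ≤ ∫ u, Λ u ∂(nHit κ m (y (Fin.last W))) := by
    calc ε.toReal * ∫ u, Λ u ∂ν = ∫ u, Λ u ∂(ε • ν) := by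
          rw [integral_smul_measure, smul_eq_mul]
      _ ≤ ∫ u, Λ u ∂(nHit κ m (y (Fin.last W))) :=
          integral_mono_measure (hmin _) (ae_of_all _ hΛ0) (integrable_of_bounded _ hΛm hΛb)
  -- Step 5: `∫ Λ dν = P_ν(initial window ∈ B) = ν_W(B)`
  have hstep5 : ∫ u, Λ u ∂ν = (Pν.map (fun x : ℕ → S => windowPath W x 0)).real B := by
    rw [hΛ, ← chain_integral_eq_integral_dirac κ ν hΨm hΨb, ← hPν,
      map_measureReal_apply (measurable_windowPath_at 0) hB,
      ← integral_indicator_one ((measurable_windowPath_at 0) hB)]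
    rfl
  have hreal : ε.toReal * (Pν.map (fun x : ℕ → S => windowPath W x 0)).real B
      ≤ (nHit (windowKernel κ W) (m + W) y).real B := by
    rw [hstep1, hstep2, hstep3, ← hstep5]
    exact hstep4
  have hne : ε * (Pν.map (fun x : ℕ → S => windowPath W x 0)) B ≠ ⊤ :=
    ENNReal.mul_ne_top (ne_top_of_le_ne_top ENNReal.one_ne_top hε1) (measure_ne_top _ _)
  rw [← ENNReal.toReal_le_toReal hne (measure_ne_top _ _), ENNReal.toReal_mul]
  exact hreal

/-! ## The invariant law of the window chain -/

/-- **THE STATIONARY WINDOW LAW IS INVARIANT.**  If `π` is invariant for `κ`, then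
`π_W = P_π.map (x ↦ (x_0, …, x_W))` is invariant for `windowKernel κ W`. -/
theorem invariant_windowKernel {π : Measure S} [IsProbabilityMeasure π] (hπ : Kernel.Invariant κ π) :
    Kernel.Invariant (windowKernel κ W)
      ((Kernel.trajMeasure (X := fun _ : ℕ => S) π
        (fun n : ℕ => κ.comap (fun hh : (i : ↥(Finset.Iic n)) → S => hh ⟨n, Finset.mem_Iic.2 le_rfl⟩)
          (measurable_pi_apply _))).map (fun x : ℕ → S => windowPath W x 0)) := by
  set P := Kernel.trajMeasure (X := fun _ : ℕ => S) π
    (fun n : ℕ => κ.comap (fun hh : (i : ↥(Finset.Iic n)) → S => hh ⟨n, Finset.mem_Iic.2 le_rfl⟩)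
      (measurable_pi_apply _)) with hP
  haveI : IsProbabilityMeasure (P.map (fun x : ℕ → S => windowPath W x 0)) :=
    Measure.isProbabilityMeasure_map (measurable_windowPath_at 0).aemeasurable
  refine invariant_of_forall_integral_real _ _ fun B hB => ?_
  have h1B : Measurable (B.indicator (1 : (Fin (W + 1) → S) → ℝ)) := measurable_one.indicator hB
  have h1Bb : ∀ v, |B.indicator (1 : (Fin (W + 1) → S) → ℝ) v| ≤ 1 := fun v => by
    by_cases hv : v ∈ B <;> simp [hv]
  have hmeas : Measurable fun v => (windowKernel κ W v).real B :=
    (Kernel.measurable_coe (windowKernel κ W) hB).ennreal_toReal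
  rw [integral_map (measurable_windowPath_at 0).aemeasurable hmeas.aestronglyMeasurable]
  have hkop : ∀ v, (windowKernel κ W v).real B
      = ∫ s, B.indicator (1 : (Fin (W + 1) → S) → ℝ) (shiftIn W v s) ∂(κ (v (Fin.last W))) := fun v => by
    rw [← integral_indicator_one hB, ← kop_windowKernel κ W h1B v]
    rfl
  have hlast : ∀ x : ℕ → S, windowPath W x 0 (Fin.last W) = x W := fun x => by
    rw [windowPath_last, Nat.zero_add]
  simp_rw [hkop, hlast]
  -- the joint tower identity at time `W`
  set pad : ((i : ↥(Finset.Iic W)) → S) → ℕ → S := fun h k =>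
    if hk : k ≤ W then h ⟨k, Finset.mem_Iic.2 hk⟩ else h ⟨W, Finset.mem_Iic.2 le_rfl⟩ with hpad
  have hpadm : Measurable pad := measurable_padIic W
  have hpad_eq : ∀ (x : ℕ → S) (j : ℕ), j ≤ W → pad (frestrictLe W x) j = x j := fun x j hj => by
    simp only [hpad, hj, dif_pos]
    rfl
  set H : ((i : ↥(Finset.Iic W)) → S) × S → ℝ :=
    fun p => B.indicator (1 : (Fin (W + 1) → S) → ℝ) (shiftIn W (windowPath W (pad p.1) 0) p.2) with hH
  have hHm : Measurable H :=
    h1B.comp (measurable_shiftIn ((measurable_windowPath_at 0).comp (hpadm.comp measurable_fst))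
      measurable_snd)
  have hHb : ∀ p, |H p| ≤ 1 := fun p => h1Bb _
  have key := chain_tower_joint κ π W hHm hHb
  rw [← hP] at key
  have hwin : ∀ x : ℕ → S, windowPath W (pad (frestrictLe W x)) 0 = windowPath W x 0 := fun x =>
    windowPath_congr (hpad_eq x) (by omega)
  have hL : ∀ x : ℕ → S, H (frestrictLe W x, x (W + 1))
      = B.indicator (1 : (Fin (W + 1) → S) → ℝ) (windowPath W (fun k => x (k + 1)) 0) := fun x => by
    have hsw := shiftIn_windowPath (W := W) x 0
    rw [show 0 + W + 1 = W + 1 by omega] at hsw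
    simp only [hH]
    rw [hwin x, hsw]
    congr 1
    funext i
    simp only [windowPath_apply]
    congr 1
    omega
  have hR : ∀ x : ℕ → S, (∫ s, H (frestrictLe W x, s) ∂(κ (x W)))
      = ∫ s, B.indicator (1 : (Fin (W + 1) → S) → ℝ) (shiftIn W (windowPath W x 0) s) ∂(κ (x W)) :=
    fun x => by simp only [hH, hwin x]
  simp_rw [hL, hR] at key
  rw [← key]
  -- stationarity of `P_π` under the shift
  have hshift : Measurable (fun (x : ℕ → S) (k : ℕ) => x (k + 1)) :=
    measurable_pi_lambda _ fun k => measurable_pi_apply _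
  have hint : Measurable fun x' : ℕ → S =>
      B.indicator (1 : (Fin (W + 1) → S) → ℝ) (windowPath W x' 0) := h1B.comp (measurable_windowPath_at 0)
  rw [← integral_map (f := fun x' : ℕ → S => B.indicator (1 : (Fin (W + 1) → S) → ℝ) (windowPath W x' 0))
    hshift.aemeasurable hint.aestronglyMeasurable, (measurePreserving_shift_chain κ hπ).map_eq,
    map_measureReal_apply (measurable_windowPath_at 0) hB,
    ← integral_indicator_one ((measurable_windowPath_at 0) hB)]
  rfl

/-! ## The law of the window path is the window chain -/

/-- **IDENTIFICATION OF PATH LAWS.**  For EVERY initial law `μ₀`: the image of the chain law `P_{μ₀}`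
under the window-path map `x ↦ (k ↦ (x_k, …, x_{k+W}))` is the law of the `windowKernel κ W`-chain
started from the law of the initial window `P_{μ₀}.map (x ↦ (x_0, …, x_W))`. -/
theorem chain_map_windowPath (μ₀ : Measure S) [IsProbabilityMeasure μ₀] :
    (Kernel.trajMeasure (X := fun _ : ℕ => S) μ₀
        (fun n : ℕ => κ.comap (fun hh : (i : ↥(Finset.Iic n)) → S => hh ⟨n, Finset.mem_Iic.2 le_rfl⟩)
          (measurable_pi_apply _))).map (windowPath W)
      = Kernel.trajMeasure (X := fun _ : ℕ => Fin (W + 1) → S)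
        ((Kernel.trajMeasure (X := fun _ : ℕ => S) μ₀
          (fun n : ℕ => κ.comap (fun hh : (i : ↥(Finset.Iic n)) → S => hh ⟨n, Finset.mem_Iic.2 le_rfl⟩)
            (measurable_pi_apply _))).map (fun x : ℕ → S => windowPath W x 0))
        (fun n : ℕ => (windowKernel κ W).comap
          (fun hh : (i : ↥(Finset.Iic n)) → (Fin (W + 1) → S) => hh ⟨n, Finset.mem_Iic.2 le_rfl⟩)
          (measurable_pi_apply _)) := by
  set P := Kernel.trajMeasure (X := fun _ : ℕ => S) μ₀
    (fun n : ℕ => κ.comap (fun hh : (i : ↥(Finset.Iic n)) → S => hh ⟨n, Finset.mem_Iic.2 le_rfl⟩)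
      (measurable_pi_apply _)) with hP
  haveI : IsProbabilityMeasure (P.map (fun x : ℕ → S => windowPath W x 0)) :=
    Measure.isProbabilityMeasure_map (measurable_windowPath_at 0).aemeasurable
  haveI : IsProbabilityMeasure (P.map (windowPath W)) :=
    Measure.isProbabilityMeasure_map (measurable_windowPath W).aemeasurable
  refine eq_chain_of_tower (windowKernel κ W) (P.map fun x : ℕ → S => windowPath W x 0) _ ?_ ?_
  · rw [Measure.map_map (measurable_pi_apply 0) (measurable_windowPath W)]
    rfl
  · intro a F hF CF hCF g hg Cg hCg
    have hm1 : Measurable fun Y : ℕ → (Fin (W + 1) → S) => F (frestrictLe a Y) * g (Y (a + 1)) :=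
      (hF.comp (measurable_frestrictLe a)).mul (hg.comp (measurable_pi_apply _))
    have hm2 : Measurable fun Y : ℕ → (Fin (W + 1) → S) =>
        F (frestrictLe a Y) * kop (windowKernel κ W) g (Y a) :=
      (hF.comp (measurable_frestrictLe a)).mul ((measurable_kop _ hg).comp (measurable_pi_apply _))
    rw [integral_map (measurable_windowPath W).aemeasurable hm1.aestronglyMeasurable,
      integral_map (measurable_windowPath W).aemeasurable hm2.aestronglyMeasurable]
    -- the joint tower identity at time `a + W`
    set pad : ((i : ↥(Finset.Iic (a + W))) → S) → ℕ → S := fun h k =>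
      if hk : k ≤ a + W then h ⟨k, Finset.mem_Iic.2 hk⟩ else h ⟨a + W, Finset.mem_Iic.2 le_rfl⟩ with hpad
    have hpadm : Measurable pad := measurable_padIic (a + W)
    have hpad_eq : ∀ (x : ℕ → S) (j : ℕ), j ≤ a + W → pad (frestrictLe (a + W) x) j = x j :=
      fun x j hj => by
        simp only [hpad, hj, dif_pos]
        rfl
    set H : ((i : ↥(Finset.Iic (a + W))) → S) × S → ℝ := fun p =>
      F (frestrictLe a (windowPath W (pad p.1))) * g (shiftIn W (windowPath W (pad p.1) a) p.2) with hH
    have hHm : Measurable H :=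
      ((hF.comp (measurable_frestrictLe a)).comp ((measurable_windowPath W).comp (hpadm.comp measurable_fst))).mul
        (hg.comp (measurable_shiftIn ((measurable_windowPath_at a).comp (hpadm.comp measurable_fst))
          measurable_snd))
    have hHb : ∀ p, |H p| ≤ CF * Cg := fun p => by
      simp only [hH]
      rw [abs_mul]
      exact mul_le_mul (hCF _) (hCg _) (abs_nonneg _)
        ((abs_nonneg (F (frestrictLe a (windowPath W (pad p.1))))).trans (hCF _))
    have key := chain_tower_joint κ μ₀ (a + W) hHm hHb
    rw [← hP] at key
    have hres : ∀ x : ℕ → S,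
        frestrictLe a (windowPath W (pad (frestrictLe (a + W) x))) = frestrictLe a (windowPath W x) :=
      fun x => by
        funext k
        rw [frestrictLe_apply, frestrictLe_apply]
        exact windowPath_congr (hpad_eq x) (by have := Finset.mem_Iic.1 k.2; omega)
    have hwin : ∀ x : ℕ → S, windowPath W (pad (frestrictLe (a + W) x)) a = windowPath W x a := fun x =>
      windowPath_congr (hpad_eq x) le_rfl
    have hL : ∀ x : ℕ → S, H (frestrictLe (a + W) x, x (a + W + 1))
        = F (frestrictLe a (windowPath W x)) * g (windowPath W x (a + 1)) := fun x => by
      simp only [hH]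
      rw [hres x, hwin x, shiftIn_windowPath]
    have hR : ∀ x : ℕ → S, (∫ s, H (frestrictLe (a + W) x, s) ∂(κ (x (a + W))))
        = F (frestrictLe a (windowPath W x)) * kop (windowKernel κ W) g (windowPath W x a) := fun x => by
      simp only [hH, hres x, hwin x]
      rw [integral_const_mul, kop_windowKernel κ W hg, windowPath_last]
    simp_rw [hL, hR] at key
    exact key

end WindowChain

end Summit.Ventures.LatticeQCDFlow.Scoring

end
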